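import Literature.NumberTheory.EllipticCurves.ProfiniteGroupDistributionDivisionNatCast
import Literature.NumberTheory.EllipticCurves.ProfiniteGroupDistributionTwistingTransfer
import HarnessLib

/-!
# Bounded distributions on a group along a subgroup tower, XIII: de Shalit's Theorem II.4.12
# ASSEMBLED at a fixed modulus — from an equivariant family of elliptic-unit measures to the measure
# `μ(𝔣)` with `δ_𝔠 μ(𝔣) = μ_𝔠` for every `𝔠`, and its integrals

De Shalit 1987, II.4.12 (p. 66–69): "there exist […] a unique `p`-adic integral measure `μ(𝔣)` on
`𝒢(𝔣) = Gal(K(𝔣𝔭^∞)/K)` such that […] (31) […] PROOF: […] Use (2.4(ii))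
`σ_𝔠(β(𝔞)) = β(𝔞𝔠)β(𝔠)^{−N𝔞}`. […] (33) `μ_𝔞 δ_𝔟 = μ_𝔟 δ_𝔞` […] We conclude that `μ_𝔞/δ_𝔞 = μ` is an
integral measure independent of `𝔞`. […] Comparing (29) with (31) concludes the proof."

This file CHAINS the kernel bricks of the series (`…Twisting`, `…Division`, `…DivisionCocycle`,
`…TwistingCharacter`, `…DivisionNatCast`, `…TwistingTransfer`) into the statement the assembler of
`μ(𝔣)` consumes at ONE modulus (one-variable `𝔭`-tower `𝒰`, `𝕜 = ℂ_p`), with the analytic input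
abstracted exactly as de Shalit uses it:

* an index type `I` ("integral ideals prime to `6𝔣𝔭`") with Artin symbols `σ : I → G`, norms
  `Nm : I → ℕ`, units `β : I → B` in a commutative monoid `B` with a `G`-action by monoid maps
  (`𝒰`, the norm-coherent semilocal units), subject to II.2.4 (ii) in the symmetric form
  `σ_𝔠 • β_𝔞 * β_𝔠^{N𝔞} = σ_𝔞 • β_𝔠 * β_𝔞^{N𝔠}` (both `= β(𝔞𝔠)`);
* an additive `G`-EQUIVARIANT family `i : B → Λ(G)` of bounded distributions (`μ_β = i(β)`, e.g.
  `GroupDistribution.induce ∘ comap ∘ invAmice₁` of the Coleman power series);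
* two ideals `𝔞₁, 𝔞₂` (`𝔞₂ = 𝔞̄₁`) with `σ_{𝔞ᵢ} ∈ U_s`, `σ_{𝔞₁}` generating `U_s` modulo every `U_n`
  with `p`-power orders unbounded in `n`, `N𝔞₁ = N𝔞₂ ≡ 1 mod p` (`mod 4` at `p = 2`), and
  `σ_{𝔞₂}^k σ_{𝔞₁}^{-k} ∉ ⋂U_n` (`k ≥ 1`); all quotients `G/U_n` abelian.

**`exists_twisting_μ_eq_forall_of_units`**: there is a bounded distribution `E` with `‖E‖ ≤ ‖μ_{𝔞₁}‖`
and `δ_{σ_𝔠, N𝔠} E = μ_𝔠` FOR EVERY `𝔠 ∈ I` (de Shalit's `12 μ(𝔣)`); **`integral_eq_of_units`**: its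
integrals against any tower-continuous multiplicative `χ` with `χ(σ_𝔠) ≠ N𝔠` are
`(χ(σ_𝔠) − N𝔠)⁻¹ ∫ χ dμ_𝔠` ((29) ↔ (31)). Everything is a theorem; no named facts, no instances,
no `sorry`.

## References

* [deShalit1987] E. de Shalit, *Iwasawa theory of elliptic curves with complex multiplication* (1987),
  II.4.12 (p. 66–69), II.2.4 (ii) (p. 43), II.4.11 (29) (p. 65).
-/

noncomputable section

open Filter
open scoped Topology Classical

namespace Literature.NumberTheory.EllipticCurves

namespace GroupDistribution

open TwistingDiv

variable {p : ℕ} [hp : Fact p.Prime]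
variable {G : Type*} [Group G] {𝒰 : SubgroupTower G} [∀ n, (𝒰.U n).Normal]
variable {B : Type*} [CommMonoid B] [MulDistribMulAction G B] {I : Type*}

/-- **de Shalit II.4.12 assembled (one modulus, `ℂ_p`, `c = N𝔞`): the measure `12μ(𝔣)` dividing ALL the
elliptic-unit measures.** See the module docstring for the hypotheses; the conclusion is a bounded
distribution `E` along `𝒰` with `‖E‖ ≤ ‖μ_{𝔞₁}‖` and `δ_{σ_𝔠,N𝔠} E = μ_𝔠 = i(β_𝔠)` levelwise for every
`𝔠 ∈ I`. (Uniqueness: `μ_eq_of_twisting_μ_eq`.)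
[cite: deShalit1987, II.4.12 (p. 66–69), II.2.4 (ii) (p. 43)] -/
theorem exists_twisting_μ_eq_forall_of_units
    (hcomm : ∀ (n : ℕ) (x y : G), x * y * x⁻¹ * y⁻¹ ∈ 𝒰.U n)
    (i : B → GroupDistribution 𝒰 ℂ_[p])
    (hi_smul : ∀ (γ : G) (b : B) (n : ℕ) (a : G ⧸ 𝒰.U n),
      (i (γ • b)).μ n a = (i b).μ n ((𝒰.proj n γ)⁻¹ * a))
    (hi_mul : ∀ (b b' : B) (n : ℕ) (a : G ⧸ 𝒰.U n), (i (b * b')).μ n a = (i b).μ n a + (i b').μ n a)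
    (β : I → B) (σ : I → G) (Nm : I → ℕ)
    (hrel : ∀ a c : I, σ c • β a * β c ^ Nm a = σ a • β c * β a ^ Nm c)
    {s : ℕ} (a₁ a₂ : I) (hσ₁ : σ a₁ ∈ 𝒰.U s) (hσ₂ : σ a₂ ∈ 𝒰.U s)
    (hgen : ∀ m, s ≤ m → ∀ u ∈ 𝒰.U s, ∃ k : ℕ, 𝒰.proj m (σ a₁ ^ k) = 𝒰.proj m u)
    (hpow : ∀ n, s ≤ n → ∃ e : ℕ, orderOf (𝒰.proj n (σ a₁)) = p ^ e)
    (hunb : ∀ e : ℕ, ∃ m, p ^ e ∣ orderOf (𝒰.proj m (σ a₁)))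
    (hN1 : 2 ≤ Nm a₁) (hpN : p ∣ Nm a₁ - 1) (h4 : p = 2 → 4 ∣ Nm a₁ - 1) (hN12 : Nm a₂ = Nm a₁)
    (hτ : ∀ k, 0 < k → ∃ n, s ≤ n ∧ σ a₂ ^ k * (σ a₁ ^ k)⁻¹ ∉ 𝒰.U n) :
    ∃ E : GroupDistribution 𝒰 ℂ_[p], E.bound = (i (β a₁)).bound ∧
      ∀ (c : I) (n : ℕ) (b : G ⧸ 𝒰.U n), (twisting (σ c) (Nm c : ℂ_[p]) E).μ n b = (i (β c)).μ n b := by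
  -- homogeneity of `i` from additivity
  have hi_one : ∀ (n : ℕ) (a : G ⧸ 𝒰.U n), (i 1).μ n a = 0 := μ_one_of_μ_mul i hi_mul
  have hi_pow : ∀ (b : B) (N n : ℕ) (a : G ⧸ 𝒰.U n), (i (b ^ N)).μ n a = (N : ℂ_[p]) * (i b).μ n a :=
    μ_pow_of_μ_mul i hi_mul hi_one
  -- the cocycle (33) for every pair, from II.2.4 (ii)
  have hcoc : ∀ (a c : I) (n : ℕ) (b : G ⧸ 𝒰.U n),
      (twisting (σ c) (Nm c : ℂ_[p]) (i (β a))).μ n b =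
        (twisting (σ a) (Nm a : ℂ_[p]) (i (β c))).μ n b :=
    fun a c n b => twisting_μ_eq_of_equivariant i hi_smul hi_mul hi_pow (hrel a c) n b
  -- division by `δ_{𝔞₁}`
  have h12 : ∀ (n : ℕ) (b : G ⧸ 𝒰.U n), (twisting (σ a₁) (Nm a₁ : ℂ_[p]) (i (β a₂))).μ n b =
      (twisting (σ a₂) (Nm a₁ : ℂ_[p]) (i (β a₁))).μ n b := by
    intro n b
    rw [hcoc a₂ a₁ n b, hN12]
  obtain ⟨E, hEb, hE⟩ := exists_twisting_μ_eq_of_cocycle_natCast hσ₁ hσ₂ hgen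
    (fun m g u hu => central_of_comm hcomm s m g u hu) hpow hunb hN1 hpN h4 hτ
    (i (β a₁)) (i (β a₂)) h12
  refine ⟨E, hEb, fun c n b => ?_⟩
  -- one division serves every `𝔠`
  exact twisting_μ_eq_of_cocycle (σ a₁) (σ c) (Nm c : ℂ_[p])
    (fun k hk => natCast_pow_ne_one hN1 hk) (fun m => proj_comm_of_comm hcomm m (σ a₁) (σ c))
    E (i (β a₁)) (i (β c)) hE (fun m b' => hcoc c a₁ m b') n b

omit [CommMonoid B] [MulDistribMulAction G B] in
/-- **The integrals of the assembled measure ((29) ↔ (31))**: with `E` as in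
`exists_twisting_μ_eq_forall_of_units` (i.e. `δ_{σ_𝔠,N𝔠} E = μ_𝔠` for every `𝔠`), for every `𝔠` and
every tower-continuous multiplicative `χ : G → ℂ_p` with `χ(1) = 1` and `χ(σ_𝔠) ≠ N𝔠`,
`∫ χ dE = (χ(σ_𝔠) − N𝔠)⁻¹ ∫ χ dμ_𝔠`. [cite: deShalit1987, II.4.12 (29)↔(31) (p. 67–69)] -/
theorem integral_eq_of_units (i : B → GroupDistribution 𝒰 ℂ_[p]) (β : I → B) (σ : I → G)
    (Nm : I → ℕ) (E : GroupDistribution 𝒰 ℂ_[p])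
    (hE : ∀ (c : I) (n : ℕ) (b : G ⧸ 𝒰.U n), (twisting (σ c) (Nm c : ℂ_[p]) E).μ n b = (i (β c)).μ n b)
    (c : I) {χ : G → ℂ_[p]} (hχc : 𝒰.IsTowerContinuous χ) (hχ : ∀ x y, χ (x * y) = χ x * χ y)
    (h1 : χ 1 = 1) (hne : χ (σ c) ≠ (Nm c : ℂ_[p])) :
    E.integral χ = (χ (σ c) - (Nm c : ℂ_[p]))⁻¹ * (i (β c)).integral χ :=
  integral_eq_of_twisting_μ_eq (σ c) (Nm c : ℂ_[p]) E (i (β c)) (hE c) hχc hχ h1 hne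

end GroupDistribution

end Literature.NumberTheory.EllipticCurves

end
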